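import Literature.Geometry.Riemannian.DirectionalBarrierMinimumPrinciple
import HarnessLib

/-!
# The parabolic maximum principle on `M × [t₁, t₂]` against subsolutions given by DIRECTIONAL
# second-order lower barriers along geodesics (one space variable)

The one-space-variable, subsolution mirror image of
`DirectionalBarrierMinimumPrinciple.directional_barrier_minimum_principle` (the comparison step of
Bamler 2020a, Cor. 3.6 / §9, in the form matching the second variation of arc length). The datum of
the subsolution `ψ` of `∂ₜ − Δ_{h(t)} ≤ c` at `(x, t)` is DIRECTIONAL: for every `η > 0` an
`h(t)`-orthonormal frame `(eᵢ)` at `x`, one-variable LOWER barriers `Bᵢ(σ) ≤ ψ(exp_x(σ eᵢ), t)`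
for `σ` near `0`, touching at `σ = 0`, twice differentiable at `0` with second derivatives `bᵢ`,
and a LOWER time barrier `Bᵗ(t') ≤ ψ(x, t')` for `t' < t` near `t`, touching, with left derivative
`p` at `t`, subject to `p − Σᵢ bᵢ ≤ c + η`.

* `le_hessian_of_directional_lower_barrier` — if `B(σ) − F(exp_x(σ v))` has a local maximum at
  `0` then `B″(0) ≤ Hess F(v, v)` (mirror of `hessian_le_of_directional_barrier`);
* `directional_barrier_maximum_principle` — for `U` continuous on the slab with `C²` slices and
  `∂ₜU = Δ U` (genuine derivative) on `(t₁, t₂]`, `ψ(t₁) ≤ U(t₁)`, and `ψ` continuous with the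
  directional datum at every `(x, t)`, `t ∈ (t₁, t₂]`, for every `η > 0`:
  `ψ ≤ U + c (t − t₁)`.

Everything is proved; no definitions, no named facts.

## References

* R. H. Bamler, *Entropy and heat kernel bounds on a Ricci flow background*, arXiv:2008.07093
  (2020), §3, proof of Thm. 3.5 and Cor. 3.6; §9, Lemma 9.15 / Prop. 9.16. [Bamler2020Entropy]
* E. Calabi, *An extension of E. Hopf's maximum principle*, Duke Math. J. 25 (1958).
-/

noncomputable section

open Bundle Set Function Filter Manifold TopologicalSpace
open scoped Manifold ContDiff Topology

namespace Literature.Geometry.Riemannian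

open Lorentzian Lorentzian.PseudoRiemannianMetric

section Directional

variable {E : Type*} [NormedAddCommGroup E] [NormedSpace ℝ E] [FiniteDimensional ℝ E]
  [CompleteSpace E] {H : Type*} [TopologicalSpace H] {I : ModelWithCorners ℝ E H}
  {M : Type*} [TopologicalSpace M] [ChartedSpace H M] [IsManifold I ∞ M] [T2Space M]
  [BoundarylessManifold I M]

/-- **`B″(0) ≤ Hess F(v, v)` from a directional lower barrier**: if `F` is `C²` near `x`, the
Levi-Civita connection is geodesically complete, and `σ ↦ B(σ) − F(exp_x(σ v))` has a local
MAXIMUM at `σ = 0` for a function `B` twice differentiable at `0` (derivative `B′` near `0`,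
`B′′(0) = b`), then `b ≤ Hess F_x(v, v)` — the second derivative of `F` along the geodesic
`σ ↦ exp_x(σ v)` at `0` is `Hess F(v, v)` (`hasDerivAt_mvfderiv_velocity_of_isGeodesicOn`) and the
second-derivative test (`Zhang2009.deriv_eq_zero_and_nonneg_of_isLocalMin`) for
`σ ↦ F(exp_x(σ v)) − B(σ)`. [folklore] -/
theorem le_hessian_of_directional_lower_barrier
    (g : PseudoRiemannianMetric I ∞ E (TangentSpace I : M → Type _)) [g.HasLeviCivita]
    [CovariantDerivative.ContMDiffCovariantDerivative g.leviCivita 1]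
    (hc : IsGeodesicallyComplete g.leviCivita) {F : M → ℝ} {x : M}
    (hF : ∀ᶠ x' in 𝓝 x, ContMDiffAt I 𝓘(ℝ, ℝ) 2 F x') (v : TangentSpace I x)
    {B B' : ℝ → ℝ} {b : ℝ} (hB : ∀ᶠ σ in 𝓝 (0 : ℝ), HasDerivAt B (B' σ) σ) (hB2 : HasDerivAt B' b 0)
    (hmax : IsLocalMax (fun σ ↦ B σ - F (expMap g.leviCivita x (σ • v))) 0) :
    b ≤ g.hessian F x v v := by
  haveI : Fact ((1 : ℕ∞ω) ≤ (∞ : ℕ∞ω)) := ⟨by exact_mod_cast le_top⟩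
  set c : ℝ → M := fun σ ↦ expMap g.leviCivita x (σ • v) with hc_def
  have hgeo : IsGeodesic g.leviCivita c := isGeodesic_expMap_smul_of_isGeodesicallyComplete hc x v
  have hc0 : c 0 = x := by
    show expMap g.leviCivita x ((0 : ℝ) • v) = x
    rw [zero_smul]; exact expMap_zero (cov := g.leviCivita) x
  have hv0 : velocity I c 0 = v := velocity_expMap_smul_zero (cov := g.leviCivita) x v
  -- differentiability of `c`, and `F` is `C²` at `c σ` for `σ` near `0`
  have hcd : ∀ σ, MDifferentiableAt 𝓘(ℝ, ℝ) I c σ := fun σ ↦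
    IsGeodesicOn.mdifferentiableAt_holds (hgeo.isGeodesicOn univ) (mem_univ σ)
  have hcont : ContinuousAt c 0 := (hcd 0).continuousAt
  have hF' : ∀ᶠ σ in 𝓝 (0 : ℝ), ContMDiffAt I 𝓘(ℝ, ℝ) 2 F (c σ) := by
    have : Tendsto c (𝓝 0) (𝓝 x) := hc0 ▸ hcont
    exact this.eventually hF
  have hF0 : ContMDiffAt I 𝓘(ℝ, ℝ) 2 F (c 0) := hF'.self_of_nhds
  -- `F ∘ c − B` has a local minimum at `0`
  have hmin : IsLocalMin (fun σ ↦ F (c σ) - B σ) 0 := by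
    have h1 := hmax.neg
    simpa only [neg_sub] using h1
  -- first derivative of `F ∘ c − B` near `0`
  have hd : ∀ᶠ σ in 𝓝 (0 : ℝ), HasDerivAt (fun σ ↦ F (c σ) - B σ)
      ((fun σ ↦ mvfderiv I F (c σ) (velocity I c σ) - B' σ) σ) σ := by
    filter_upwards [hB, hF'] with σ hBσ hFσ
    exact (hasDerivAt_comp_curve_mvfderiv (hFσ.mdifferentiableAt (by simp)) (hcd σ)).sub hBσ
  -- second derivative at `0`
  have hd2 : HasDerivAt (fun σ ↦ mvfderiv I F (c σ) (velocity I c σ) - B' σ)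
      (g.hessian F (c 0) (velocity I c 0) (velocity I c 0) - b) 0 :=
    (g.hasDerivAt_mvfderiv_velocity_of_isGeodesicOn (hgeo.isGeodesicOn univ) (mem_univ 0) hF0).sub
      hB2
  obtain ⟨-, h2⟩ := Zhang2009.deriv_eq_zero_and_nonneg_of_isLocalMin hmin hd hd2
  rw [hv0] at h2
  rw [hc0] at h2
  linarith

end Directional

section Comparison

variable {E : Type*} [NormedAddCommGroup E] [NormedSpace ℝ E] [FiniteDimensional ℝ E]
  [CompleteSpace E] {H : Type*} [TopologicalSpace H] {I : ModelWithCorners ℝ E H} [I.Boundaryless]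
  {M : Type*} [TopologicalSpace M] [ChartedSpace H M] [IsManifold I ∞ M] [T2Space M] [CompactSpace M]
  {h : ℝ → PseudoRiemannianMetric I ∞ E (TangentSpace I : M → Type _)}

/-- **The maximum principle against a subsolution given by directional lower barriers** (the
comparison step of Bamler 2020a, Cor. 3.6 / Lemma 9.15, in second-variation form, one space
variable). Let `h` be a family of Riemannian metrics on a compact manifold without boundary,
`ψ, U : M → ℝ → ℝ` continuous on `M × [t₁, t₂]`, `U` with `C²` slices and `∂ₜU = Δ_{h(t)} U` at
every `(x, t)`, `t ∈ (t₁, t₂]`, and `ψ(t₁) ≤ U(t₁)`. Suppose that at every `(x, t)`,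
`t ∈ (t₁, t₂]`, and for every `η > 0` there are an `h(t)`-orthonormal frame `e` at `x`,
one-variable lower barriers `Bᵢ ≤ ψ(exp_x(σ eᵢ), t)` near `σ = 0`, touching, twice differentiable
at `0` with second derivatives `bᵢ`, and a time barrier `Bᵗ ≤ ψ(x, ·)` on the left of `t`,
touching, with left derivative `p`, such that `p − Σ bᵢ ≤ c + η`. Then `ψ ≤ U + c (t − t₁)` on
`M × [t₁, t₂]`. [cite: Bamler2020Entropy, §3, proof of Cor. 3.6] -/
theorem directional_barrier_maximum_principle [∀ r, (h r).HasLeviCivita]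
    (hR : ∀ r, (h r).IsRiemannian) {t₁ t₂ : ℝ}
    {ψ U : M → ℝ → ℝ}
    (hψc : ContinuousOn (fun p : M × ℝ ↦ ψ p.1 p.2) (univ ×ˢ Icc t₁ t₂))
    (hUc : ContinuousOn (fun p : M × ℝ ↦ U p.1 p.2) (univ ×ˢ Icc t₁ t₂))
    (hUx : ∀ t ∈ Ioc t₁ t₂, ContMDiff I 𝓘(ℝ, ℝ) 2 fun x ↦ U x t)
    (hUt : ∀ x, ∀ t ∈ Ioc t₁ t₂, HasDerivAt (fun s ↦ U x s)
      ((h t).laplaceBeltrami (fun x' ↦ U x' t) x) t)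
    {c : ℝ}
    (hbar : ∀ x, ∀ t ∈ Ioc t₁ t₂, ∀ η > 0,
      ∃ (e : Fin (Module.finrank ℝ E) → TangentSpace I x)
        (B B' : Fin (Module.finrank ℝ E) → ℝ → ℝ)
        (b : Fin (Module.finrank ℝ E) → ℝ) (Bt : ℝ → ℝ) (p : ℝ),
        (∀ i j, (h t).val x (e i) (e j) = if i = j then 1 else 0) ∧
        (∀ i, (∀ᶠ σ in 𝓝 (0 : ℝ), HasDerivAt (B i) (B' i σ) σ) ∧ HasDerivAt (B' i) (b i) 0 ∧
          B i 0 = ψ x t ∧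
          ∀ᶠ σ in 𝓝 (0 : ℝ), B i σ ≤ ψ (expMap (h t).leviCivita x (σ • e i)) t) ∧
        (HasDerivWithinAt Bt p (Iic t) t ∧ Bt t = ψ x t ∧ ∀ᶠ t' in 𝓝[<] t, Bt t' ≤ ψ x t') ∧
        p - ∑ i, b i ≤ c + η)
    (h0 : ∀ x, ψ x t₁ ≤ U x t₁) :
    ∀ x, ∀ t ∈ Icc t₁ t₂, ψ x t ≤ U x t + c * (t - t₁) := by
  haveI : Fact ((1 : ℕ∞ω) ≤ (∞ : ℕ∞ω)) := ⟨by exact_mod_cast le_top⟩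
  have h2 : (2 : ℕ∞ω) ≤ (∞ : ℕ∞ω) := WithTop.coe_le_coe.mpr le_top
  -- it suffices to prove the bound with `c + δ` for every `δ > 0`
  suffices hδ : ∀ δ > 0, ∀ x, ∀ t ∈ Icc t₁ t₂, ψ x t ≤ U x t + (c + δ) * (t - t₁) by
    intro x t ht
    refine le_of_forall_pos_le_add fun ε hε ↦ ?_
    rcases eq_or_lt_of_le ht.1 with heq | hlt
    · subst heq; have := h0 x; linarith
    · have := hδ (ε / (t - t₁)) (by positivity) x t ht
      rw [add_mul, div_mul_cancel₀ _ (by linarith)] at this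
      linarith
  intro δ hδ x t ht
  by_contra hneg
  rw [not_le] at hneg
  -- `W = U + (c + δ)(t − t₁) − ψ` attains a negative minimum on the compact slab
  set K : Set (M × ℝ) := univ ×ˢ Icc t₁ t₂ with hK
  have hKc : IsCompact K := isCompact_univ.prod isCompact_Icc
  set W : M × ℝ → ℝ := fun p ↦ U p.1 p.2 + (c + δ) * (p.2 - t₁) - ψ p.1 p.2 with hW
  have hWc : ContinuousOn W K :=
    (hUc.add (continuousOn_const.mul (continuous_snd.continuousOn.sub continuousOn_const))).sub hψc
  obtain ⟨p₀, hp₀K, hp₀⟩ := hKc.exists_isMinOn ⟨(x, t), mem_univ _, ht⟩ hWc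
  have hWneg : W p₀ < 0 := by
    have h1 : W p₀ ≤ W (x, t) := hp₀ (show ((x, t) : M × ℝ) ∈ K from ⟨mem_univ _, ht⟩)
    have h2' : W (x, t) < 0 := by simp only [hW]; linarith
    exact h1.trans_lt h2'
  obtain ⟨x₀, t₀⟩ := p₀
  obtain ⟨-, ht₀⟩ := hp₀K
  simp only at ht₀ hWneg
  have ht₀1 : t₁ < t₀ := by
    rcases eq_or_lt_of_le ht₀.1 with heq | hlt
    · exfalso
      have := h0 x₀
      simp only [hW, ← heq, sub_self, mul_zero, add_zero] at hWneg
      linarith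
    · exact hlt
  have ht₀' : t₀ ∈ Ioc t₁ t₂ := ⟨ht₀1, ht₀.2⟩
  -- the minimum property against points of the slab
  have hmin : ∀ x', ∀ t' ∈ Icc t₁ t₂, W (x₀, t₀) ≤ W (x', t') := fun x' t' ht' ↦
    hp₀ (show ((x', t') : M × ℝ) ∈ K from ⟨mem_univ _, ht'⟩)
  -- the directional datum at `(x₀, t₀)` with `η = δ/2`
  obtain ⟨e, B, B', b, Bt, p, heon, hB, ⟨hBt, hBt0, hBtdom⟩, hineq⟩ :=
    hbar x₀ t₀ ht₀' (δ / 2) (by positivity)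
  -- geometry of `h t₀`
  set g := h t₀ with hg_def
  haveI : CovariantDerivative.ContMDiffCovariantDerivative g.leviCivita 1 :=
    contMDiffCovariantDerivative_leviCivita_of_two_le g h2
  have hcpl : IsGeodesicallyComplete g.leviCivita := isGeodesicallyComplete_of_compactSpace g h2 (hR t₀)
  have hcard : Fintype.card (Fin (Module.finrank ℝ E)) = Module.finrank ℝ E := Fintype.card_fin _
  -- (i) space directions: `bᵢ ≤ Hess U (eᵢ, eᵢ)`
  have hix : ∀ i, b i ≤ g.hessian (fun x' ↦ U x' t₀) x₀ (e i) (e i) := by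
    intro i
    obtain ⟨hB1, hB2, hB0, hdom⟩ := hB i
    refine le_hessian_of_directional_lower_barrier g hcpl
      (Eventually.of_forall fun x' ↦ hUx t₀ ht₀' x') (e i) hB1 hB2 ?_
    -- local maximum of `B i σ − U(exp(σ eᵢ), t₀)` at `0`
    filter_upwards [hdom] with σ hσ
    have hexp0 : expMap g.leviCivita x₀ ((0 : ℝ) • e i) = x₀ := by
      rw [zero_smul]; exact expMap_zero (cov := g.leviCivita) x₀
    have h1 := hmin (expMap g.leviCivita x₀ (σ • e i)) t₀ ht₀
    simp only [hW] at h1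
    have key : B i σ - U (expMap g.leviCivita x₀ (σ • e i)) t₀ ≤ B i 0 - U x₀ t₀ := by
      rw [hB0]; linarith
    simpa only [hexp0] using key
  -- the Laplacian is the frame sum of the Hessians
  have hL : ∑ i, b i ≤ g.laplaceBeltrami (fun x' ↦ U x' t₀) x₀ := by
    rw [laplaceBeltrami_eq_sum_hessian g x₀ heon hcard]
    exact Finset.sum_le_sum fun i _ ↦ hix i
  -- (ii) time: `U(x₀, ·) + (c + δ)(· − t₁) − Bᵗ` has a minimum from the left at `t₀`
  have hit : g.laplaceBeltrami (fun x' ↦ U x' t₀) x₀ + (c + δ) - p ≤ 0 := by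
    have hd : HasDerivWithinAt (fun s ↦ U x₀ s + (c + δ) * (s - t₁) - Bt s)
        (g.laplaceBeltrami (fun x' ↦ U x' t₀) x₀ + (c + δ) - p) (Iic t₀) t₀ := by
      have h1 := ((hUt x₀ t₀ ht₀').hasDerivWithinAt.add
        ((((hasDerivAt_id t₀).sub_const t₁).const_mul (c + δ)).hasDerivWithinAt)).sub hBt
      simp only [mul_one] at h1
      exact h1
    refine hasDerivWithinAt_nonpos_of_isLocalMin_left hd ?_
    have h2' : ∀ᶠ s in 𝓝[<] t₀, s ∈ Icc t₁ t₂ := by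
      filter_upwards [Ioo_mem_nhdsLT ht₀1] with s hs
      exact ⟨hs.1.le, hs.2.le.trans ht₀.2⟩
    filter_upwards [hBtdom, h2'] with s hs hsI
    have h1 := hmin x₀ s hsI
    simp only [hW] at h1
    rw [hBt0]
    linarith
  -- contradiction
  linarith

end Comparison

end Literature.Geometry.Riemannian

end
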